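import Literature.NumberTheory.EllipticCurves.BurungaleCastellaSkinner2025.VexingPrimesProofs
import Literature.NumberTheory.EllipticCurves.NonEisensteinPrimeOfSurjective
import HarnessLib

/-!
# The ORDINARY two-variable Iwasawa main conjecture for `E/K` over the `ℤ_p²`-extension
# ("`ch_{Λ_K}(X^ord(E/K_∞)) = (L_p^PR(E/K))`"; Burungale–Castella–Skinner 2025, statement 4.1.1 =
# Yan–Zhu 2026, statement 4.1 (1)) — TYPED as an obligation leaf (`@[conjecture]`, nothing asserted),
# with its kernel bookkeeping PROVED

STAGED by the cross-ladder literature-typing layer (cell `bsd-littype`, seat 03, gen 3; D-0088(4);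
HOME `run/shared/lean/pub/bsd-littype/`, sheet `staging/bsd-littype-03/SHEETS-03.md` §1 row 21 /
§4 "statements 4.1.1/4.1.2") for planners and ideation cells.  Conjectures are not Literature
(CONVENTIONS §4: a Literature `def X : Prop` must cite a source that PROVES `X`), so the one
two-variable statement that BCS 2025 / Yan–Zhu 2026 STATE in general and PROVE on a locus is filed
here, in EXACTLY the currency of the two named facts of the tree that prove it on their loci —
`BurungaleCastellaSkinner2025.thm141_XOrd₂_isTorsion_charIdeal_eq_perrinRiou` (IMRN 2025, Thm. 1.4.1
(b): (sur), `V = ∅`, (Heeg), (disc), (spl), `p > 3`) and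
`YanZhu2026.thm42_XOrd₂_isTorsion_charIdeal_le_perrinRiou` (J. Algebra 2026, Thm. 4.2 (1) + (Im):
`ρ̄_E|_{G_K}` absolutely irreducible, (Heeg), (spl), `p > 2`) — so that routes can name the OPEN cases
BY NAME: no Heegner hypothesis; (irr_K) without (sur)/(Im); `V ≠ ∅`; `p = 3`.  HONEST FRAMING (cell,
verbatim): "no tranche here proves BSD; … typed ≠ proved ≠ endorsed".  Nothing in this file is
asserted: two `@[conjecture]` predicates and PROVED edges.  The companion statement 4.1.2 of the
source (GREENBERG side, `X_Gr(E/K_∞)` versus the two-variable `L_p^Gr(E/K) ∈ Λ_K^ur`) is NOT typed: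
the tree has `WeierstrassCurve.XGr₂` but no carrier for `L_p^Gr` ([CGS23, Def. 1.4.3] = Math. Ann.
393 Def. 2.4.3: `h_K · 𝓛_v(K)⁻ · 𝓛_p(f/K, Σ^{(2')})`, whose missing piece is Hida's type-II
Rankin–Selberg function with Petersson norms of CM theta series; GAP note of
`YanZhu2026/TwoVariableMainTheorems.lean`, sheet SHEETS-03 §6).

## The printed statements

A. Burungale, F. Castella, C. Skinner, *Base change and Iwasawa main conjectures for GL₂*, IMRN 2025
rnaf082 = arXiv:2405.00270v2, §4.1, p. 8 (`[corpus: paper:arxiv-2405.00270 p0008 L2–L14]`):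

> **4.1. Two-variable Main Conjectures.** **4.1.1.** Let `g ∈ S₂(Γ₀(N))` be a newform and `p > 2` a
> prime of good ordinary reduction for `g`. Let `K` be an imaginary quadratic field satisfying
> (irr_K). Then `X_ord(g/K_∞)` is `Λ_K`-torsion, with `(L_p^PR(g/K)) = ch_{Λ_K}(X_ord(g/K_∞))`.
> Note that it follows from the comparison of `p`-adic `L`-functions in [Wan15, Prop. 84] that
> [4.1.1] is nothing but [2.2.1] in the current setting.

with (p. 4, `[p0004 L60–L64]`) "`K_∞/K` the `ℤ_p²`-extension of `K`, `Γ_K = Gal(K_∞/K)`,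
`Λ_K = ℤ_p[[Γ_K]]`, `X^ord(E/K_∞)` the Pontryagin dual of `Sel_{p^∞}(E/K_∞)`, and `L_p^PR(E/K) ∈ Λ_K`
the two-variable `p`-adic Rankin `L`-series constructed by Perrin-Riou [PR88] (normalized as in
[CGS23, §1.2])", (p. 7, `[p0007 L56–L60]`) "We refer the reader to §§1.2 and 1.4 of [CGS23] for …
`L_p^PR(g/K) ∈ Λ_K`", (p. 8, `[p0008 L44–L45]`) "(irr_K): `ρ̄_g` is irreducible as
`G_K`-representation".  X. Yan, X. Zhu, J. Algebra **693** (2026) = arXiv:2412.20078v4, §4.1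
statement 4.1 (1) (l.917–922): "`𝒳_{𝓕_ord}(E/K_∞)` is `Λ_K`-torsion and
`Char_{Λ_K}(𝒳_{𝓕_ord}(E/K_∞)) = (𝓛_p^PR(E/K))`" (setting: `p > 2` split in `K`, `(N, D_K) = 1`,
`E` good ordinary at `p`, `ρ̄_E|_{G_K}` irreducible).  STATUS IN PRINT: BCS Thm. 1.4.1 and YZ Thm.
4.2 (1) + (Im) prove it on the loci above (edges below); [SU14]/[CW22] are "complements" (BCS Rem.
1.4.2); OPEN as printed otherwise.

## Transcription (tree vocabulary only; every carrier cited by name, none re-declared)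

Exactly that of `thm141_…` (module docstring of `BurungaleCastellaSkinner2025/TwoVariableMainTheorem.lean`)
and `thm42_…` (`YanZhu2026/TwoVariableMainTheorems.lean`): `E = W/ℚ` a globally minimal model with a
modular parametrisation `π : ModularParametrizationData W N` by `X₀(N)` (`π.f = f_E`, `N = N_E`;
`deg π_E`, `c_E` enter `L_p^PR`'s normalisation [CGS23, Def. 1.2.2]); `Γ_K` through a pair
`(κ₁, κ₂)` of `ℤ_p`-extensions of `K` with an adapted topological generator pair `(γ₁, γ₂)`
(`ZpExtension.IsTopGeneratorPair`, `Fact` instance), so `Λ_K = IwasawaAlgebra₂ p`;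
`X^ord(E/K_∞) = (W.baseChange K).XOrd₂ p κ₁ κ₂ γ₁ γ₂` (`TwoVariableSelmerDual.lean`);
`L_p^PR(E/K) = perrinRiouLFunction W π F` for `F = 𝓛_p(f_E/K, Σ^{(1)})` characterised by
`IsHidaRankinLFunction ι W κ₁ κ₂ π.f F` ([CGS23, Thm. 1.2.1] = YZ Thm. 3.3; reading flag
`YZ-33-range`) with `IsCongruenceIntegral π.f F` ("`∈ c_f⁻¹Λ_K`"); "`=` as ideals of `Λ_K`" = the
pair `IdealLeSpan ∧ SpanLeIdeal` read along the injective `toCycAnti : Λ_K → ℚ_p⟦T⟧⟦S⟧`.  The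
`L`-side is ∃-quantified over the characterising predicate, exactly as in both named facts.

READING of the hypotheses of the quantified sentence `bcs2025_statement_4_1_1` (WEAKER than print =
special case, never stronger): besides the printed "`p > 2` good ordinary" (`3 ≤ p`, `GoodOrd W p`),
"`K` imaginary quadratic" (`IsImaginaryQuadratic K`) and (irr_K)
(`(W.baseChange K).HasIrreducibleModPGaloisRep p`), it carries the two STANDING hypotheses of
[CGS23, §1] (= Math. Ann. 393 §2, l.697–701 of the published TeX: "`K` an imaginary quadratic field
of discriminant `D_K < 0` prime to `N`, and assume that (spl) `(p) = v v̄` splits in `K`") under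
which "`L_p^PR` normalized as in [CGS23, §1.2]" is defined at all: (spl) (two primes of `𝒪_K` over
`p`) and `(N, D_K) = 1`; and it is the `E`-case of a statement printed for every newform
`g ∈ S₂(Γ₀(N))`.
-- TODO(general form): newforms `g ∈ S₂(Γ₀(N))` with arbitrary coefficient field (needs `X_ord(g/K_∞)` over `𝒪_λ⟦Γ_K⟧`).

## What this file declares

* `OrdinaryTwoVariableMainConjectureAt ι W K κ₁ κ₂ γ₁ γ₂ π` — the statement AT a datum (the common
  conclusion shape of `thm141_…` (b) and `thm42_…` + (Im)): `∃ F`, `IsHidaRankinLFunction … F ∧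
  IsCongruenceIntegral π.f F ∧ X torsion ∧ ch(X) ⊂ (𝓛) ∧ (𝓛) ⊂ ch(X)`; `bcs2025_statement_4_1_1` —
  the printed sentence (E-case, with the standing hypotheses above).  Both `@[conjecture]`.
* PROVED edges (kernel bookkeeping, no new mathematics):
  (1) `of_thm141_of_surj` — BCS Thm. 1.4.1 (b) gives the statement at `(E, K, p)` under (sur),
  `V = ∅`, (Heeg), (disc), (spl), `p > 3`; and `of_thm141_of_surj_of_forall_not_dvd` — the same with
  "`V = ∅`" DISCHARGED from the conductor (no prime `ℓ ∣ N_E` with `p ∣ ℓ + 1`;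
  `vexingPrimes_eq_empty_of_forall_not_dvd` of `VexingPrimesProofs.lean`);
  (2) `of_yanZhu_thm42_of_bigIm` — YZ Thm. 4.2 (1) + (Im) gives it under absolute irreducibility of
  `ρ̄_E|_{G_K}`, (Heeg), (spl), `p > 2`;
  (3) consequences AT a datum: torsion (`isTorsion`), the rational form "in `Λ_K ⊗ ℚ_p`" of BCS
  Thm. 1.4.1 (a) (`rat`), and "`ch(X)` is principal, generated by an element mapping to `L_p^PR`"
  (`charIdeal_eq_span`);
  (4) `at_of_statement` — the sentence specialises to the statement at every datum on its locus.

Consumers (OPEN-QUESTIONS-03 OQ-5/OQ-7; LADDER-BSD K3/D1, flag `BCS25-IMC-equiv@BSTW`): the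
two-variable cells (BSTW §9–10, X10b), planners wanting a `--conditional-on` leaf for the ordinary
two-variable IMC, and the cyclotomic-descent glue (YZ Lemma 5.3 / Prop. 3.7, littype-04's
`lemma53_…`, `prop37_…`).  A planner who wants it under
`Summits/BirchSwinnertonDyer/BirchSwinnertonDyer/Theorems/` should MOVE this file, not restate it.

## References
* [BurungaleCastellaSkinner2025] IMRN 2025 rnaf082 = arXiv:2405.00270v2: §4.1 statement 4.1.1 (p. 8),
  §1.4 (p. 4), Thm. 1.4.1, Rem. 1.4.2, proof of Thm. 1.4.1 (p. 11).
* [YanZhu2024MainConjNonCM] J. Algebra 693 (2026) = arXiv:2412.20078v4: statement 4.1 (1) (l.917–922),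
  Thm. 4.2 (l.932–949), Thm. 3.3 / Def. 3.4.
* [CastellaGrossiSkinner2025] Math. Ann. 393 (2025) = arXiv:2303.04373: §1 setting (spl), §1.2 of v1
  (= §2.2 of print) — the normalisation of `L_p^PR`.
* B. Perrin-Riou, J. London Math. Soc. (2) 38 (1988) ([PR88], the construction).
-/

noncomputable section

open scoped Classical

open PowerSeries NumberField IsDedekindDomain Field CongruenceSubgroup
  Literature.NumberTheory.GaloisRepresentations Literature.NumberTheory.EllipticCurves
  Literature.NumberTheory.EllipticCurves.ModularForms Literature.NumberTheory.EllipticCurves.Rank1Residual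
  Literature.NumberTheory.EllipticCurves.IwasawaAlgebra₂
  Literature.NumberTheory.EllipticCurves.BurungaleCastellaSkinner2025

namespace Summit.BirchSwinnertonDyer.Rank1Residual.TwoVariableIMC

/-- **The ordinary two-variable main conjecture AT a datum — TYPED** (Burungale–Castella–Skinner 2025
statement 4.1.1 = Yan–Zhu 2026 statement 4.1 (1), `E`-case): for `E = W/ℚ` with modular
parametrisation `π` by `X₀(N)`, the field `K`, the prime `p`, `Γ_K` through `(κ₁, κ₂; γ₁, γ₂)` and an
embedding datum `ι`: "there is `F = 𝓛_p(f_E/K, Σ^{(1)})` with the interpolation property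
(`IsHidaRankinLFunction`, [CGS23, Thm. 1.2.1]) and `∈ c_f⁻¹Λ_K` (`IsCongruenceIntegral`) such that,
with `L_p^PR(E/K) = perrinRiouLFunction W π F` and `X = X^ord(E/K_∞) = XOrd₂`: `X` is `Λ_K`-torsion
and `ch_{Λ_K}(X) = (L_p^PR(E/K))` as ideals of `Λ_K`" (`IdealLeSpan ∧ SpanLeIdeal`).  LITERALLY the
(b)-conclusion of `thm141_…` and the (Im)-conclusion of `YanZhu2026.thm42_…`.  A predicate; nothing
asserted; OPEN in general (known loci: the edges below).
[cite: BurungaleCastellaSkinner2025, statement 4.1.1 (§4.1, p. 8 of arXiv:2405.00270v2) with §1.4 (p. 4)]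
[cite: YanZhu2024MainConjNonCM, statement 4.1 (1) (arXiv:2412.20078v4 TeX l.917–922)] -/
@[conjecture] def OrdinaryTwoVariableMainConjectureAt {p : ℕ} [Fact p.Prime]
    (ι : integralClosure ℚ ℂ →+* ℂ_[p]) (W : WeierstrassCurve ℚ) [W.IsElliptic] [W.IsGloballyMinimal]
    (K : Type) [Field K] [NumberField K] (κ₁ κ₂ : ZpExtension K p) (γ₁ γ₂ : absoluteGaloisGroup K)
    [Fact (ZpExtension.IsTopGeneratorPair κ₁ κ₂ γ₁ γ₂)] {N : ℕ} [NeZero N]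
    (π : ModularParametrizationData W N) : Prop :=
  ∃ F : CycAntiSeries p, IsHidaRankinLFunction ι W κ₁ κ₂ π.f F ∧ IsCongruenceIntegral π.f F ∧
    Module.IsTorsion (IwasawaAlgebra₂ p) ((W.baseChange K).XOrd₂ p κ₁ κ₂ γ₁ γ₂) ∧
    IdealLeSpan (WeierstrassCurve.XOrd₂.charIdeal (W.baseChange K) p κ₁ κ₂ γ₁ γ₂)
      (perrinRiouLFunction W π F) ∧
    SpanLeIdeal (perrinRiouLFunction W π F)
      (WeierstrassCurve.XOrd₂.charIdeal (W.baseChange K) p κ₁ κ₂ γ₁ γ₂)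

/-- **Burungale–Castella–Skinner 2025, statement 4.1.1 (§4.1, p. 8), `E`-case, verbatim**: "Let
`g ∈ S₂(Γ₀(N))` be a newform and `p > 2` a prime of good ordinary reduction for `g`. Let `K` be an
imaginary quadratic field satisfying (irr_K). Then `X_ord(g/K_∞)` is `Λ_K`-torsion, with
`(L_p^PR(g/K)) = ch_{Λ_K}(X_ord(g/K_∞))`."  Transcribed for `g = f_E` with the two standing hypotheses
of the normalisation "[CGS23, §1.2]" that the statement presupposes — (spl) and `(N, D_K) = 1` —
made explicit (WEAKER than print: special case).  A statement STATED, and proved on a locus, by the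
source; nothing asserted here.
-- TODO(general form): arbitrary newforms `g ∈ S₂(Γ₀(N))`; drop (spl)/(N, D_K) = 1 once `L_p^PR` has a carrier outside [CGS23, §1]'s setting.
[cite: BurungaleCastellaSkinner2025, statement 4.1.1 (§4.1, p. 8 of arXiv:2405.00270v2) with (irr_K) (p. 8) and §1.4 (p. 4)]
[cite: CastellaGrossiSkinner2025, §1 setting of arXiv:2303.04373v1 (= §2 of print, TeX l.697–701: (spl), D_K prime to N) and §1.2 (normalisation of L_p^PR)] -/
@[conjecture] def bcs2025_statement_4_1_1 : Prop :=
  ∀ {p : ℕ} [Fact p.Prime] (ι : integralClosure ℚ ℂ →+* ℂ_[p]) (W : WeierstrassCurve ℚ) [W.IsElliptic]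
    [W.IsGloballyMinimal] (K : Type) [Field K] [NumberField K] (κ₁ κ₂ : ZpExtension K p)
    (γ₁ γ₂ : absoluteGaloisGroup K) [Fact (ZpExtension.IsTopGeneratorPair κ₁ κ₂ γ₁ γ₂)]
    {N : ℕ} [NeZero N] (π : ModularParametrizationData W N),
    3 ≤ p → GoodOrd W p → IsImaginaryQuadratic K →
      ((Ideal.span {(p : ℤ)}).primesOver (𝓞 K)).ncard = 2 →
      IsCoprime (N : ℤ) (NumberField.discr K) →
      (W.baseChange K).HasIrreducibleModPGaloisRep p →
    OrdinaryTwoVariableMainConjectureAt ι W K κ₁ κ₂ γ₁ γ₂ π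

variable {p : ℕ} [Fact p.Prime] {K : Type} [Field K] [NumberField K]

/-- Unfolding lemma. [cite: BurungaleCastellaSkinner2025, statement 4.1.1 (§4.1, p. 8 of arXiv:2405.00270v2)] -/
theorem ordinaryTwoVariableMainConjectureAt_iff (ι : integralClosure ℚ ℂ →+* ℂ_[p])
    (W : WeierstrassCurve ℚ) [W.IsElliptic] [W.IsGloballyMinimal] (κ₁ κ₂ : ZpExtension K p)
    (γ₁ γ₂ : absoluteGaloisGroup K) [Fact (ZpExtension.IsTopGeneratorPair κ₁ κ₂ γ₁ γ₂)] {N : ℕ}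
    [NeZero N] (π : ModularParametrizationData W N) :
    OrdinaryTwoVariableMainConjectureAt ι W K κ₁ κ₂ γ₁ γ₂ π ↔
      ∃ F : CycAntiSeries p, IsHidaRankinLFunction ι W κ₁ κ₂ π.f F ∧ IsCongruenceIntegral π.f F ∧
        Module.IsTorsion (IwasawaAlgebra₂ p) ((W.baseChange K).XOrd₂ p κ₁ κ₂ γ₁ γ₂) ∧
        IdealLeSpan (WeierstrassCurve.XOrd₂.charIdeal (W.baseChange K) p κ₁ κ₂ γ₁ γ₂)
          (perrinRiouLFunction W π F) ∧
        SpanLeIdeal (perrinRiouLFunction W π F)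
          (WeierstrassCurve.XOrd₂.charIdeal (W.baseChange K) p κ₁ κ₂ γ₁ γ₂) :=
  Iff.rfl

/-! ### (1) BCS Thm. 1.4.1 (b) ⟹ the statement at `(E, K, p)` under (sur), `V = ∅` — PROVED -/

/-- **BCS Thm. 1.4.1 (b) gives statement 4.1.1 at `(E, K, p)`** on its locus: `p > 3` good ordinary,
(irr_ℚ) — automatic from (sur) —, `K` imaginary quadratic with (Heeg), (spl), (disc), `V = ∅`, and
(sur).  (The printed "proof of the two-variable Iwasawa Main Conjectures … under an additional
hypothesis on `E[p]`", §1.4.) [cite: BurungaleCastellaSkinner2025, Thm. 1.4.1 (b) (§1.4, p. 4 of arXiv:2405.00270v2)] -/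
theorem of_thm141_of_surj (h : thm141_XOrd₂_isTorsion_charIdeal_eq_perrinRiou)
    (ι : integralClosure ℚ ℂ →+* ℂ_[p]) (W : WeierstrassCurve ℚ) [W.IsElliptic] [W.IsGloballyMinimal]
    (κ₁ κ₂ : ZpExtension K p) (γ₁ γ₂ : absoluteGaloisGroup K)
    [Fact (ZpExtension.IsTopGeneratorPair κ₁ κ₂ γ₁ γ₂)] {N : ℕ} [NeZero N]
    (π : ModularParametrizationData W N) (hp : 3 < p) (hord : GoodOrd W p)
    (hK : IsImaginaryQuadratic K) (hHeeg : SatisfiesHeegnerHypothesis N K)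
    (hsplit : ((Ideal.span {(p : ℤ)}).primesOver (𝓞 K)).ncard = 2) (hodd : Odd (NumberField.discr K))
    (h3 : NumberField.discr K ≠ -3) (hV : vexingPrimes W p = ∅) (hsur : Surj W p) :
    OrdinaryTwoVariableMainConjectureAt ι W K κ₁ κ₂ γ₁ γ₂ π := by
  haveI : NeZero (p : ℚ) := ⟨Nat.cast_ne_zero.mpr (Fact.out : p.Prime).ne_zero⟩
  obtain ⟨F, hF, hc, htor, -, hint⟩ := h ι W K κ₁ κ₂ γ₁ γ₂ π hp hord
    (hasIrreducibleModPGaloisRep_of_hasSurjectiveModNGaloisRep W p hsur)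
    hK hHeeg hsplit hodd h3 hV
  exact ⟨F, hF, hc, htor, (hint hsur).1, (hint hsur).2⟩

/-- **The same with "`V = ∅`" discharged from the conductor**: if no prime `ℓ ∣ N_E` satisfies
`ℓ ≡ −1 (mod p)` then `V = ∅` (`vexingPrimes_eq_empty_of_forall_not_dvd`, PROVED in
`VexingPrimesProofs.lean`), so BCS Thm. 1.4.1 (b) gives statement 4.1.1 at `(E, K, p)` under (sur),
(Heeg), (spl), (disc), `p > 3` and that arithmetic condition on `N_E` alone.
[cite: BurungaleCastellaSkinner2025, Thm. 1.4.1 (b) and §1.4 (the set V) (p. 4 of arXiv:2405.00270v2)] -/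
theorem of_thm141_of_surj_of_forall_not_dvd (h : thm141_XOrd₂_isTorsion_charIdeal_eq_perrinRiou)
    (ι : integralClosure ℚ ℂ →+* ℂ_[p]) (W : WeierstrassCurve ℚ) [W.IsElliptic] [W.IsGloballyMinimal]
    (κ₁ κ₂ : ZpExtension K p) (γ₁ γ₂ : absoluteGaloisGroup K)
    [Fact (ZpExtension.IsTopGeneratorPair κ₁ κ₂ γ₁ γ₂)] {N : ℕ} [NeZero N]
    (π : ModularParametrizationData W N) (hp : 3 < p) (hord : GoodOrd W p)
    (hK : IsImaginaryQuadratic K) (hHeeg : SatisfiesHeegnerHypothesis N K)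
    (hsplit : ((Ideal.span {(p : ℤ)}).primesOver (𝓞 K)).ncard = 2) (hodd : Odd (NumberField.discr K))
    (h3 : NumberField.discr K ≠ -3)
    (hN : ∀ ℓ : ℕ, ℓ.Prime → ℓ ∣ W.conductorNorm ℤ → ¬ p ∣ ℓ + 1) (hsur : Surj W p) :
    OrdinaryTwoVariableMainConjectureAt ι W K κ₁ κ₂ γ₁ γ₂ π :=
  of_thm141_of_surj h ι W κ₁ κ₂ γ₁ γ₂ π hp hord hK hHeeg hsplit hodd h3
    (vexingPrimes_eq_empty_of_forall_not_dvd W hN) hsur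

/-! ### (2) Yan–Zhu Thm. 4.2 (1) + (Im) ⟹ the statement at `(E, K, p)` — PROVED -/

/-- **Yan–Zhu 2026 Thm. 4.2 (1) with its (Im) clause gives statement 4.1.1 at `(E, K, p)`** on its
locus: `p > 2` good ordinary split in the imaginary quadratic `K`, Heegner hypothesis, `ρ̄_E|_{G_K}`
absolutely irreducible, and (Im) (`BigIm W p`).
[cite: YanZhu2024MainConjNonCM, Thm. 4.2 (1) and the (Im) clause (arXiv:2412.20078v4 TeX l.932–949)]
[cite: BurungaleCastellaSkinner2025, Rem. 1.4.2 (p. 4 of arXiv:2405.00270v2)] -/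
theorem of_yanZhu_thm42_of_bigIm (h : YanZhu2026.thm42_XOrd₂_isTorsion_charIdeal_le_perrinRiou)
    (ι : integralClosure ℚ ℂ →+* ℂ_[p]) (W : WeierstrassCurve ℚ) [W.IsElliptic] [W.IsGloballyMinimal]
    (κ₁ κ₂ : ZpExtension K p) (γ₁ γ₂ : absoluteGaloisGroup K)
    [Fact (ZpExtension.IsTopGeneratorPair κ₁ κ₂ γ₁ γ₂)] {N : ℕ} [NeZero N]
    (π : ModularParametrizationData W N) (hp : 3 ≤ p) (hord : GoodOrd W p)
    (hK : IsImaginaryQuadratic K) (hsplit : ((Ideal.span {(p : ℤ)}).primesOver (𝓞 K)).ncard = 2)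
    (hHeeg : SatisfiesHeegnerHypothesis N K)
    (habs : ∀ ρ : ModPGaloisRep K (ZMod p) 2, (W.baseChange K).IsTorsionGaloisRep p ρ →
      FramedRep.IsAbsolutelyIrreducible ρ) (hIm : BigIm W p) :
    OrdinaryTwoVariableMainConjectureAt ι W K κ₁ κ₂ γ₁ γ₂ π := by
  obtain ⟨F, hF, hc, htor, hle, hge⟩ := h ι W K κ₁ κ₂ γ₁ γ₂ π hp hord hK hsplit hHeeg habs
  exact ⟨F, hF, hc, htor, hle, hge hIm⟩

/-! ### (3) Consequences AT a datum — PROVED -/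

section Consequences

variable {ι : integralClosure ℚ ℂ →+* ℂ_[p]} {W : WeierstrassCurve ℚ} [W.IsElliptic]
  [W.IsGloballyMinimal] {κ₁ κ₂ : ZpExtension K p} {γ₁ γ₂ : absoluteGaloisGroup K}
  [Fact (ZpExtension.IsTopGeneratorPair κ₁ κ₂ γ₁ γ₂)] {N : ℕ} [NeZero N]
  {π : ModularParametrizationData W N}

/-- The statement at a datum gives: `X^ord(E/K_∞)` is `Λ_K`-torsion.
[cite: BurungaleCastellaSkinner2025, statement 4.1.1 (torsion clause, p. 8 of arXiv:2405.00270v2)] -/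
theorem isTorsion (h : OrdinaryTwoVariableMainConjectureAt ι W K κ₁ κ₂ γ₁ γ₂ π) :
    Module.IsTorsion (IwasawaAlgebra₂ p) ((W.baseChange K).XOrd₂ p κ₁ κ₂ γ₁ γ₂) := by
  obtain ⟨-, -, -, htor, -, -⟩ := h
  exact htor

/-- The statement at a datum gives the RATIONAL equality "`ch(X) = (L_p^PR)` in `Λ_K ⊗ ℚ_p`" — the
shape of BCS Thm. 1.4.1 (a) (`IdealLeSpanRat ∧ SpanLeIdealRat`).
[cite: BurungaleCastellaSkinner2025, Thm. 1.4.1 (a) and statement 4.1.1 (pp. 4, 8 of arXiv:2405.00270v2)] -/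
theorem rat (h : OrdinaryTwoVariableMainConjectureAt ι W K κ₁ κ₂ γ₁ γ₂ π) :
    ∃ F : CycAntiSeries p, IsHidaRankinLFunction ι W κ₁ κ₂ π.f F ∧ IsCongruenceIntegral π.f F ∧
      IdealLeSpanRat (WeierstrassCurve.XOrd₂.charIdeal (W.baseChange K) p κ₁ κ₂ γ₁ γ₂)
          (perrinRiouLFunction W π F) ∧
        SpanLeIdealRat (perrinRiouLFunction W π F)
          (WeierstrassCurve.XOrd₂.charIdeal (W.baseChange K) p κ₁ κ₂ γ₁ γ₂) := by
  obtain ⟨F, hF, hc, -, hle, hge⟩ := h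
  exact ⟨F, hF, hc, hle.rat, hge.rat⟩

/-- The statement at a datum in the form "`ch_{Λ_K}(X^ord(E/K_∞))` is the principal ideal of `Λ_K`
generated by an element `g` mapping to `L_p^PR(E/K)`" (the two inclusions give equality of ideals;
`IdealLeSpan.eq_span_of_spanLeIdeal`).
[cite: BurungaleCastellaSkinner2025, statement 4.1.1 (p. 8 of arXiv:2405.00270v2)]
[cite: YanZhu2024MainConjNonCM, statement 4.1 (1) (arXiv:2412.20078v4 TeX l.917–922)] -/
theorem charIdeal_eq_span (h : OrdinaryTwoVariableMainConjectureAt ι W K κ₁ κ₂ γ₁ γ₂ π) :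
    ∃ (F : CycAntiSeries p) (g : IwasawaAlgebra₂ p), IsHidaRankinLFunction ι W κ₁ κ₂ π.f F ∧
      IsCongruenceIntegral π.f F ∧ toCycAnti p g = perrinRiouLFunction W π F ∧
      WeierstrassCurve.XOrd₂.charIdeal (W.baseChange K) p κ₁ κ₂ γ₁ γ₂ = Ideal.span {g} := by
  obtain ⟨F, hF, hc, -, hle, hge⟩ := h
  obtain ⟨g, -, hgL, hspan⟩ := hle.eq_span_of_spanLeIdeal hge
  exact ⟨F, g, hF, hc, hgL, hspan⟩

end Consequences

/-! ### (4) The sentence specialises to the statement at a datum — PROVED -/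

/-- Granted the printed sentence, the statement holds at every datum on its locus (`p > 2` good
ordinary, `K` imaginary quadratic, (spl), `(N, D_K) = 1`, (irr_K)).
[cite: BurungaleCastellaSkinner2025, statement 4.1.1 (§4.1, p. 8 of arXiv:2405.00270v2)] -/
theorem at_of_statement (h : bcs2025_statement_4_1_1) (ι : integralClosure ℚ ℂ →+* ℂ_[p])
    (W : WeierstrassCurve ℚ) [W.IsElliptic] [W.IsGloballyMinimal] (κ₁ κ₂ : ZpExtension K p)
    (γ₁ γ₂ : absoluteGaloisGroup K) [Fact (ZpExtension.IsTopGeneratorPair κ₁ κ₂ γ₁ γ₂)] {N : ℕ}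
    [NeZero N] (π : ModularParametrizationData W N) (hp : 3 ≤ p) (hord : GoodOrd W p)
    (hK : IsImaginaryQuadratic K) (hsplit : ((Ideal.span {(p : ℤ)}).primesOver (𝓞 K)).ncard = 2)
    (hcop : IsCoprime (N : ℤ) (NumberField.discr K))
    (hirrK : (W.baseChange K).HasIrreducibleModPGaloisRep p) :
    OrdinaryTwoVariableMainConjectureAt ι W K κ₁ κ₂ γ₁ γ₂ π :=
  h ι W K κ₁ κ₂ γ₁ γ₂ π hp hord hK hsplit hcop hirrK

/-- Conversely-shaped bookkeeping: on the (sur), `V = ∅`, (Heeg), (disc), (spl), `p > 3` locus the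
printed sentence is a THEOREM of the source (Thm. 1.4.1 (b)) — granted that named fact, the sentence
restricted to this locus holds; recorded as the implication between the two typed objects.
[cite: BurungaleCastellaSkinner2025, Thm. 1.4.1 (b) and statement 4.1.1 (pp. 4, 8 of arXiv:2405.00270v2)] -/
theorem statement_on_thm141_locus (h : thm141_XOrd₂_isTorsion_charIdeal_eq_perrinRiou) :
    ∀ {p : ℕ} [Fact p.Prime] (ι : integralClosure ℚ ℂ →+* ℂ_[p]) (W : WeierstrassCurve ℚ)
      [W.IsElliptic] [W.IsGloballyMinimal] (K : Type) [Field K] [NumberField K]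
      (κ₁ κ₂ : ZpExtension K p) (γ₁ γ₂ : absoluteGaloisGroup K)
      [Fact (ZpExtension.IsTopGeneratorPair κ₁ κ₂ γ₁ γ₂)] {N : ℕ} [NeZero N]
      (π : ModularParametrizationData W N),
      3 < p → GoodOrd W p → IsImaginaryQuadratic K → SatisfiesHeegnerHypothesis N K →
        ((Ideal.span {(p : ℤ)}).primesOver (𝓞 K)).ncard = 2 → Odd (NumberField.discr K) →
        NumberField.discr K ≠ -3 → vexingPrimes W p = ∅ → Surj W p →
      OrdinaryTwoVariableMainConjectureAt ι W K κ₁ κ₂ γ₁ γ₂ π :=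
  fun ι W _ _ _ _ _ κ₁ κ₂ γ₁ γ₂ _ _ _ π hp hord hK hHeeg hsplit hodd h3 hV hsur ↦
    of_thm141_of_surj h ι W κ₁ κ₂ γ₁ γ₂ π hp hord hK hHeeg hsplit hodd h3 hV hsur

end Summit.BirchSwinnertonDyer.Rank1Residual.TwoVariableIMC

end
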